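import Literature.NumberTheory.EllipticCurves.WeightOneEtaQuotientsProofs
import HarnessLib

/-!
# The cusp form `η(3τ)⁸ ∈ S₄(Γ₀(9))`

Topic `NumberTheory/EllipticCurves` (modular forms for `Γ₀(N)`), namespace
`Literature.NumberTheory.EllipticCurves.ModularForms`.  Definitions with bodies, all statements
proved, no named fact.

* complements to the tree's level restriction `ofLevelLe` (`WeightOneEtaQuotientsProofs`):
  `ofLevelLe_apply`, `ofLevelLe_ne_zero`; `Gamma0_nine_le_three` (from `gamma0_le_gamma0_of_dvd`).
* `etaOcticNine = η(3τ)⁸`, realised as `(η²|₁D₃)⁴` with the tree's `etaSq`, `tpD`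
  (`ModularCurveEtaProductsProofs`): `Γ₀(9)`-invariant in weight `4`
  (`etaOcticNine_slash_of_mem` — by the multiplier formula `etaSq_slash_tpD_slash` each factor
  `η(3τ)²` picks up `e^{πi e/6}` under `γ = (p q; 9k s)`, `e = e(p, 3q, 3k, s)`, and
  `3 ∣ e` identically, `three_dvd_etaSqExp_level_nine`), holomorphic, vanishing at every cusp
  (`isZeroAtImInfty_etaSq_slash_tpD_slash`); whence
  **`cuspFormEtaOcticNine : CuspForm (Gamma0 9) 4`** and `etaOcticNineForm : ModularForm (Gamma0 9) 4`,
  nonzero and non-vanishing on `ℍ`.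

`η(3τ)⁸` is an `η`-quotient satisfying Ligozat's criteria (Diamond–Shurman §3.2 for the method);
it enters the tree as the denominator of
Weber's `γ₂(3τ) = E₄(3τ)/η(3τ)⁸ ∈ ℂ(X₀(9))` (Cox, *Primes of the form x² + ny²*, Prop. 12.3), the
modular function behind the cube-root statement `γ₂(τ₀) ∈ ℚ(j(τ₀))` (Cox Thm. 12.2) needed for
the complex-multiplication input of `Literature.Barriers.ABC.OWeakUniformABCImpliesNoSiegelZeros`.

## References

* F. Diamond, J. Shurman, *A First Course in Modular Forms*, GTM 228, 2005, §1.2, §3.2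
  (`η`-products, Prop. 3.2.2 for the method). [DiamondShurman2005]
* D. A. Cox, *Primes of the form x² + ny²*, 2nd ed., 2013, §12.A Prop. 12.3. [Cox2013]
-/

noncomputable section

open UpperHalfPlane hiding I
open Complex ModularForm CongruenceSubgroup Matrix.SpecialLinearGroup
open scoped MatrixGroups Real ModularForm Manifold

namespace Literature.NumberTheory.EllipticCurves.ModularForms

/-! ### Restriction of the level: small complements to the tree's `ofLevelLe` -/

/-- `ofLevelLe f τ = f τ` (the tree's level restriction `ofLevelLe`, `WeightOneEtaQuotientsProofs`). [folklore] -/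
theorem ofLevelLe_apply {Γ Γ' : Subgroup SL(2, ℤ)} (h : Γ ≤ Γ') {k : ℤ}
    (f : ModularForm Γ' k) (τ : ℍ) : ofLevelLe h f τ = f τ := rfl

/-- `ofLevelLe f ≠ 0` for `f ≠ 0`. [folklore] -/
theorem ofLevelLe_ne_zero {Γ Γ' : Subgroup SL(2, ℤ)} (h : Γ ≤ Γ') {k : ℤ}
    {f : ModularForm Γ' k} (hf : f ≠ 0) : ofLevelLe h f ≠ 0 := by
  intro h0
  apply hf
  apply DFunLike.ext
  intro τ
  have := congrArg (fun g : ModularForm Γ k ↦ g τ) h0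
  simpa using this

/-- `Γ₀(9) ≤ Γ₀(3)` (the tree's `gamma0_le_gamma0_of_dvd`). [folklore] -/
theorem Gamma0_nine_le_three : Gamma0 9 ≤ Gamma0 3 :=
  gamma0_le_gamma0_of_dvd (by norm_num : 3 ∣ 9)

/-! ### `η(3τ)⁸` is a cusp form of weight `4` for `Γ₀(9)` -/

/-- The exponent of the multiplier of `η(3τ)²` under `γ = (p q; 9k s) ∈ Γ₀(9)` is divisible by `3`:
`e(p, 3q, 3k, s) = 3·(…)`. [folklore] -/
theorem three_dvd_etaSqExp_level_nine (p q k s : ℤ) :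
    (3 : ℤ) ∣ etaSqExp p (3 * q) (3 * k) s := by
  refine ⟨(1 - (3 * k) ^ 2) * (q * s + (3 * k - 1) * s + k + 1) + k * (p + s - 3), ?_⟩
  simp only [etaSqExp]
  ring

/-- `φ₉(τ) = η(3τ)⁸`, realised as `(η²|₁D₃)⁴`. [folklore] -/
def etaOcticNine : ℍ → ℂ :=
  (etaSq ∣[(1 : ℤ)] tpD 3) * (etaSq ∣[(1 : ℤ)] tpD 3) * (etaSq ∣[(1 : ℤ)] tpD 3) *
    (etaSq ∣[(1 : ℤ)] tpD 3)

/-- `φ₉(τ) = η(3τ)⁸`. [folklore] -/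
theorem etaOcticNine_apply (τ : ℍ) : etaOcticNine τ = η (3 * (τ : ℂ)) ^ 8 := by
  simp only [etaOcticNine, Pi.mul_apply, etaSq_slash_tpD_apply]
  push_cast
  ring

/-- `φ₉(τ) ≠ 0` on `ℍ`. [folklore] -/
theorem etaOcticNine_ne_zero (τ : ℍ) : etaOcticNine τ ≠ 0 := by
  rw [etaOcticNine_apply]
  refine pow_ne_zero _ (ModularForm.eta_ne_zero ?_)
  simpa using mul_pos (by norm_num : (0 : ℝ) < 3) τ.2

/-- **`φ₉ = η(3τ)⁸` is `Γ₀(9)`-invariant in weight `4`**: each factor `η(3τ)²` picks up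
`e^{πi e/6}` with `3 ∣ e`, so the product picks up `e^{2πi e/3} = 1`. [folklore] -/
theorem etaOcticNine_slash_of_mem {γ : SL(2, ℤ)} (hγ : γ ∈ Gamma0 9) :
    etaOcticNine ∣[(4 : ℤ)] γ = etaOcticNine := by
  rw [Gamma0_mem] at hγ
  obtain ⟨k, hk⟩ := (ZMod.intCast_zmod_eq_zero_iff_dvd _ 9).mp hγ
  have hc : γ 1 0 = ((3 : ℕ) : ℤ) * (3 * k) := by rw [hk]; push_cast; ring
  set f := etaSq ∣[(1 : ℤ)] tpD 3 with hf
  have h1 : f ∣[(1 : ℤ)] (γ : GL (Fin 2) ℝ) =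
      cexp (π * I / 6 * etaSqExp (γ 0 0) (3 * γ 0 1) (3 * k) (γ 1 1)) • f := by
    have := etaSq_slash_tpD_slash 3 hc
    simpa using this
  set c : ℂ := cexp (π * I / 6 * etaSqExp (γ 0 0) (3 * γ 0 1) (3 * k) (γ 1 1)) with hcdef
  have hc4 : c ^ 4 = 1 := by
    obtain ⟨m, hm⟩ := three_dvd_etaSqExp_level_nine (γ 0 0) (γ 0 1) k (γ 1 1)
    rw [hcdef, ← Complex.exp_nat_mul, hm]
    push_cast
    rw [show (4 : ℂ) * (π * I / 6 * (3 * (m : ℂ))) = m * (2 * π * I) by ring]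
    exact Complex.exp_int_mul_two_pi_mul_I m
  have h2 := ModularForm.mul_slash_SL2 1 1 γ f f
  have h3 := ModularForm.mul_slash_SL2 2 1 γ (f * f) f
  have h4 := ModularForm.mul_slash_SL2 3 1 γ (f * f * f) f
  rw [show (1 : ℤ) + 1 = 2 by norm_num] at h2
  rw [show (2 : ℤ) + 1 = 3 by norm_num] at h3
  rw [show (3 : ℤ) + 1 = 4 by norm_num] at h4
  rw [etaOcticNine, ← hf, h4, h3, h2, ModularForm.SL_slash, h1]
  ext τ
  simp only [Pi.mul_apply, Pi.smul_apply, smul_eq_mul]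
  have : c * f τ * (c * f τ) * (c * f τ) * (c * f τ) = c ^ 4 * (f τ * f τ * f τ * f τ) := by ring
  rw [this, hc4, one_mul]

/-- `φ₉` is holomorphic on `ℍ`. [folklore] -/
theorem mdifferentiable_etaOcticNine : MDifferentiable 𝓘(ℂ) 𝓘(ℂ) etaOcticNine :=
  (((mdifferentiable_etaSq.slash _ _).mul (mdifferentiable_etaSq.slash _ _)).mul
    (mdifferentiable_etaSq.slash _ _)).mul (mdifferentiable_etaSq.slash _ _)

/-- All `SL₂(ℤ)`-translates of `φ₉` vanish at `i∞`. [folklore] -/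
theorem isZeroAtImInfty_etaOcticNine_slash (γ : SL(2, ℤ)) :
    IsZeroAtImInfty (etaOcticNine ∣[(4 : ℤ)] (γ : GL (Fin 2) ℝ)) := by
  set f := etaSq ∣[(1 : ℤ)] tpD 3 with hf
  have h2 := ModularForm.mul_slash_SL2 1 1 γ f f
  have h3 := ModularForm.mul_slash_SL2 2 1 γ (f * f) f
  have h4 := ModularForm.mul_slash_SL2 3 1 γ (f * f * f) f
  rw [show (1 : ℤ) + 1 = 2 by norm_num] at h2
  rw [show (2 : ℤ) + 1 = 3 by norm_num] at h3
  rw [show (3 : ℤ) + 1 = 4 by norm_num] at h4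
  simp only [ModularForm.SL_slash] at h2 h3 h4
  rw [etaOcticNine, ← hf, h4, h3, h2]
  have h0 := isZeroAtImInfty_etaSq_slash_tpD_slash 3 γ
  have h := ((h0.mul h0).mul h0).mul h0
  simp only [mul_zero] at h
  exact h

/-- **The cusp form `η(3τ)⁸ ∈ S₄(Γ₀(9))`**, its modularity proved from the multiplier system of
`η²` of `ModularCurveEtaProductsProofs`.  (Remark, not used or proved here: classically this is the
normalised newform of `S₄(Γ₀(9))`.) [folklore] -/
def cuspFormEtaOcticNine : CuspForm (Gamma0 9) 4 where
  toFun := etaOcticNine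
  slash_action_eq' A hA := by
    obtain ⟨γ, hγ, rfl⟩ := hA
    exact etaOcticNine_slash_of_mem hγ
  holo' := mdifferentiable_etaOcticNine
  zero_at_cusps' hc := by
    rw [Subgroup.IsArithmetic.isCusp_iff_isCusp_SL2Z] at hc
    rw [OnePoint.isZeroAt_iff_forall_SL2Z hc]
    intro γ _
    exact isZeroAtImInfty_etaOcticNine_slash γ

/-- The underlying function of `cuspFormEtaOcticNine`. [folklore] -/
@[simp] theorem coe_cuspFormEtaOcticNine :
    (cuspFormEtaOcticNine : ℍ → ℂ) = etaOcticNine := rfl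

/-- `η(3τ)⁸` as a modular form of weight `4` for `Γ₀(9)`. [folklore] -/
def etaOcticNineForm : ModularForm (Gamma0 9) 4 :=
  ModularFormClass.modularForm cuspFormEtaOcticNine

/-- `etaOcticNineForm τ = η(3τ)⁸`. [folklore] -/
@[simp] theorem etaOcticNineForm_apply (τ : ℍ) : etaOcticNineForm τ = η (3 * (τ : ℂ)) ^ 8 := by
  rw [← etaOcticNine_apply]; rfl

/-- `etaOcticNineForm ≠ 0`. [folklore] -/
theorem etaOcticNineForm_ne_zero : etaOcticNineForm ≠ 0 := by
  intro h
  have := congrArg (fun f : ModularForm (Gamma0 9) 4 ↦ f UpperHalfPlane.I) h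
  rw [etaOcticNineForm_apply] at this
  simp only [ModularForm.zero_apply] at this
  exact absurd this (by rw [← etaOcticNine_apply]; exact etaOcticNine_ne_zero _)

end Literature.NumberTheory.EllipticCurves.ModularForms

end
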